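import Literature.Analysis.FluidPDE.BiotSavartIntegral
import HarnessLib

/-!
# Route `ExtremiserTransience`, crux `NearExtremalTransiencePerFlow` (stmt-NavierStokesRegularity-26567), LINE g10-1 «two_thirds»
# (ns-idea-10 g10), stub S2 `FirstOrderIdentity`: the LINEAR-GROWTH GAUGE is logarithmic (sup bound)

Helper file for S2 (`--supports stmt-NavierStokesRegularity-26567`).  The Euler–Lagrange test of S2 is `curl (χψ)` with `ψ` a
local vector potential of the limit field `V`; the card of the line (`Cruxes/NearExtremalTransience/Lines/two_thirds.md`, S2 and
«Gauge remark») asks for the gauge `ψ = K ∗ (ζV)` (Biot–Savart of a truncation of `V`) and records that under LINEAR ENERGY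
GROWTH `∫_{B(x,r)} ‖V‖² ≤ A_E·r` it is only logarithmically large: `|ψ| ≲ √A_E · log R` («dyadic Cauchy–Schwarz»).  This file
proves that bound in an elementary explicit form (AM–GM on dyadic balls instead of Cauchy–Schwarz, so `A_E` appears linearly):

* `inv_sq_le_dyadic_sum` — for `1 ≤ ‖z‖ < 2^{K+1}`: `‖z‖⁻² ≤ Σ_{k ≤ K} 4^{-k}·1_{‖z‖ < 2^{k+1}}`;
* `setIntegral_norm_le_of_ballEnergy` — `∫_{B(x,r)} ‖V‖ ≤ r²(A_E + 4π/3)/2` from `∫_{B(x,r)} ‖V‖² ≤ A_E r` (AM–GM);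
* `norm_biotSavart_le_of_ballEnergy` — for any `w` with `‖w‖ ≤ min(1, ‖V‖)` whose support lies within `2^{K+1}` of `x`:
  `‖(K ∗ w)(x)‖ ≤ 1 + (K+1)(A_E + 4π/3)/(2π)`.

HONEST FRAMING: potential-theoretic lemmas about vector fields on `ℝ³`; nothing about Navier–Stokes regularity or blow-up is
proved; S2, the crux ⟨26567⟩ and NS regularity are OPEN; no summit is proved by a line. [folklore]
-/

noncomputable section

open MeasureTheory Set Filter Topology Metric
open scoped ENNReal RealInnerProductSpace
open Literature.Analysis.FluidPDE

namespace Summit.NavierStokesRegularity.NavierStokesRegularity.Theorems.NearExtremalTransiencePerFlow.TwoThirds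

-- the summit's namespace repeats the problem name by convention (D-0017)
set_option linter.dupNamespace false

/-- DYADIC BOUND: for `1 ≤ ‖z‖ < 2^{K+1}`, `‖z‖⁻² ≤ Σ_{k ≤ K} 4^{-k}·1_{‖z‖ < 2^{k+1}}` (take the `k` with
`2^k ≤ ‖z‖ < 2^{k+1}`). [folklore] -/
theorem inv_sq_le_dyadic_sum {z : EuclideanSpace ℝ (Fin 3)} {K : ℕ} (hz1 : 1 ≤ ‖z‖) (hzK : ‖z‖ < 2 ^ (K + 1)) :
    (‖z‖ ^ 2)⁻¹ ≤ ∑ k ∈ Finset.range (K + 1), ((4 : ℝ) ^ k)⁻¹ * (if ‖z‖ < (2 : ℝ) ^ (k + 1) then (1 : ℝ) else 0) := by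
  obtain ⟨n, hn1, hn2⟩ := exists_nat_pow_near hz1 (by norm_num : (1 : ℝ) < 2)
  have hnK : n < K + 1 := by
    by_contra h
    push Not at h
    have h2 : (2 : ℝ) ^ (K + 1) ≤ 2 ^ n := pow_le_pow_right₀ (by norm_num) h
    linarith
  have hmem : n ∈ Finset.range (K + 1) := Finset.mem_range.2 hnK
  have hterm : (‖z‖ ^ 2)⁻¹ ≤ ((4 : ℝ) ^ n)⁻¹ * (if ‖z‖ < (2 : ℝ) ^ (n + 1) then (1 : ℝ) else 0) := by
    rw [if_pos hn2, mul_one]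
    have h4 : (4 : ℝ) ^ n = (2 ^ n) ^ 2 := by
      rw [← pow_mul, mul_comm, pow_mul]; norm_num
    rw [h4]
    have hpos : 0 < ((2 : ℝ) ^ n) ^ 2 := by positivity
    exact inv_anti₀ hpos (pow_le_pow_left₀ (by positivity) hn1 2)
  refine hterm.trans (Finset.single_le_sum
    (f := fun k => ((4 : ℝ) ^ k)⁻¹ * (if ‖z‖ < (2 : ℝ) ^ (k + 1) then (1 : ℝ) else 0)) (fun k _ => ?_) hmem)
  split_ifs <;> positivity

/-- AM–GM on a ball: `∫_{B(x,r)} ‖V‖ ≤ (r/2)∫_{B(x,r)}‖V‖² + vol(B(x,r))/(2r) ≤ r²(A_E + 4π/3)/2` under the ball-energy bound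
`∫_{B(x,r)} ‖V‖² ≤ A_E·r`. [folklore] -/
theorem setIntegral_norm_le_of_ballEnergy {V : EuclideanSpace ℝ (Fin 3) → EuclideanSpace ℝ (Fin 3)}
    (hV : Continuous V) {x : EuclideanSpace ℝ (Fin 3)} {A_E r : ℝ} (hr : 0 < r)
    (hE : ∫ y in ball x r, ‖V y‖ ^ 2 ≤ A_E * r) :
    ∫ y in ball x r, ‖V y‖ ≤ r ^ 2 * (A_E + 4 * Real.pi / 3) / 2 := by
  have hmeas : volume (ball x r) < ∞ := measure_ball_lt_top
  have hint1 : IntegrableOn (fun y => ‖V y‖) (ball x r) :=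
    (hV.norm.continuousOn.integrableOn_compact (isCompact_closedBall x r)).mono_set ball_subset_closedBall
  have hint2 : IntegrableOn (fun y => ‖V y‖ ^ 2) (ball x r) :=
    ((hV.norm.pow 2).continuousOn.integrableOn_compact (isCompact_closedBall x r)).mono_set ball_subset_closedBall
  have hint3 : IntegrableOn (fun y => r / 2 * ‖V y‖ ^ 2 + 1 / (2 * r)) (ball x r) :=
    (hint2.const_mul _).add (integrableOn_const hmeas.ne)
  have hpt : ∀ y, ‖V y‖ ≤ r / 2 * ‖V y‖ ^ 2 + 1 / (2 * r) := by
    intro y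
    have e : r / 2 * ‖V y‖ ^ 2 + 1 / (2 * r) - ‖V y‖ = (r * ‖V y‖ - 1) ^ 2 / (2 * r) := by
      field_simp
      ring
    have key : 0 ≤ (r * ‖V y‖ - 1) ^ 2 / (2 * r) := by positivity
    linarith
  have hvol : volume.real (ball x r) = r ^ 3 * (Real.pi * 4 / 3) := by
    rw [measureReal_def, EuclideanSpace.volume_ball_fin_three, ENNReal.toReal_mul, ← ENNReal.ofReal_pow hr.le,
      ENNReal.toReal_ofReal (by positivity), ENNReal.toReal_ofReal (by positivity)]
  calc ∫ y in ball x r, ‖V y‖ ≤ ∫ y in ball x r, (r / 2 * ‖V y‖ ^ 2 + 1 / (2 * r)) :=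
        setIntegral_mono hint1 hint3 hpt
    _ = r / 2 * (∫ y in ball x r, ‖V y‖ ^ 2) + volume.real (ball x r) * (1 / (2 * r)) := by
        rw [integral_add (hint2.const_mul _) (integrableOn_const hmeas.ne), integral_const_mul, setIntegral_const,
          smul_eq_mul]
    _ ≤ r / 2 * (A_E * r) + (r ^ 3 * (Real.pi * 4 / 3)) * (1 / (2 * r)) := by
        rw [hvol]
        have h2r : 0 ≤ r / 2 := by positivity
        nlinarith [mul_le_mul_of_nonneg_left hE h2r]
    _ = r ^ 2 * (A_E + 4 * Real.pi / 3) / 2 := by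
        field_simp

/-- **THE LINEAR-GROWTH GAUGE IS LOGARITHMIC (sup bound).**  Let `V` be continuous with `∫_{B(x,r)} ‖V‖² ≤ A_E·r` for all
`r > 0` (linear energy growth at `x`), and let `w` be any field with `‖w‖ ≤ 1`, `‖w‖ ≤ ‖V‖` and support within distance
`2^{K+1}` of `x` (typically `w = ζV` with a cutoff `ζ`; no regularity of `w` is needed — the Bochner integral is `0` when the
integrand is not integrable).  Then the Biot–Savart potential of `w` obeys
`‖(K ∗ w)(x)‖ ≤ 1 + (K+1)(A_E + 4π/3)/(2π)`: the near unit ball contributes `≤ 1`, and each dyadic shell `2^k ≤ ‖x−y‖ < 2^{k+1}`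
contributes `≤ (A_E + 4π/3)/(2π)` (kernel `≤ (4π)⁻¹‖x−y‖⁻²`, AM–GM on `B(x,2^{k+1})`). [folklore] -/
theorem norm_biotSavart_le_of_ballEnergy {V w : EuclideanSpace ℝ (Fin 3) → EuclideanSpace ℝ (Fin 3)}
    {x : EuclideanSpace ℝ (Fin 3)} {A_E : ℝ} {K : ℕ}
    (hV : Continuous V) (hw1 : ∀ y, ‖w y‖ ≤ 1) (hwV : ∀ y, ‖w y‖ ≤ ‖V y‖)
    (hsupp : ∀ y, w y ≠ 0 → dist y x < (2 : ℝ) ^ (K + 1))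
    (hE : ∀ r : ℝ, 0 < r → ∫ y in ball x r, ‖V y‖ ^ 2 ≤ A_E * r) :
    ‖biotSavart w x‖ ≤ 1 + (K + 1) * (A_E + 4 * Real.pi / 3) / (2 * Real.pi) := by
  have hπ : 0 < Real.pi := Real.pi_pos
  -- the majorant
  set M : EuclideanSpace ℝ (Fin 3) → ℝ := fun y => (4 * Real.pi)⁻¹ * (nearProfile₂ 1 ‖x - y‖ +
    ∑ k ∈ Finset.range (K + 1), ((4 : ℝ) ^ k)⁻¹ * (ball x ((2 : ℝ) ^ (k + 1))).indicator (fun y => ‖V y‖) y) with hM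
  -- integrability of the pieces
  have hballint : ∀ k : ℕ, Integrable ((ball x ((2 : ℝ) ^ (k + 1))).indicator fun y => ‖V y‖) := by
    intro k
    rw [integrable_indicator_iff measurableSet_ball]
    exact (hV.norm.continuousOn.integrableOn_compact (isCompact_closedBall x _)).mono_set ball_subset_closedBall
  have hsumint : Integrable fun y => ∑ k ∈ Finset.range (K + 1),
      ((4 : ℝ) ^ k)⁻¹ * (ball x ((2 : ℝ) ^ (k + 1))).indicator (fun y => ‖V y‖) y :=
    integrable_finsetSum _ fun k _ => (hballint k).const_mul _
  have hnearint : Integrable fun y : EuclideanSpace ℝ (Fin 3) => nearProfile₂ 1 ‖x - y‖ :=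
    (integrable_nearProfile₂_norm one_pos).comp_sub_left x
  have hMint : Integrable M := (hnearint.add hsumint).const_mul _
  -- the pointwise bound `‖K(x − y) (w y)‖ ≤ M y`
  have hpt : ∀ y, ‖biotSavartKernel (x - y) (w y)‖ ≤ M y := by
    intro y
    have hK : ‖biotSavartKernel (x - y) (w y)‖ ≤ (4 * Real.pi)⁻¹ * ‖w y‖ * (‖x - y‖ ^ 2)⁻¹ :=
      norm_biotSavartKernel_le (x - y) (w y)
    have hsum0 : 0 ≤ ∑ k ∈ Finset.range (K + 1),
        ((4 : ℝ) ^ k)⁻¹ * (ball x ((2 : ℝ) ^ (k + 1))).indicator (fun y => ‖V y‖) y :=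
      Finset.sum_nonneg fun k _ => mul_nonneg (by positivity) (Set.indicator_nonneg (fun _ _ => norm_nonneg _) _)
    have hnear0 : 0 ≤ nearProfile₂ 1 ‖x - y‖ := nearProfile₂_nonneg _ _
    by_cases hwy : w y = 0
    · rw [hwy, biotSavartKernel_zero_right, norm_zero]
      simp only [hM]
      exact mul_nonneg (by positivity) (add_nonneg hnear0 hsum0)
    have hdist : dist y x < (2 : ℝ) ^ (K + 1) := hsupp y hwy
    rw [dist_comm, dist_eq_norm] at hdist
    by_cases hnear : ‖x - y‖ < 1
    · -- near: `‖K‖ ≤ (4π)⁻¹ ‖x−y‖⁻² = (4π)⁻¹ · nearProfile₂ 1 ‖x−y‖`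
      have hprof : nearProfile₂ 1 ‖x - y‖ = (‖x - y‖ ^ 2)⁻¹ := by
        unfold nearProfile₂; rw [if_pos hnear]
      calc ‖biotSavartKernel (x - y) (w y)‖ ≤ (4 * Real.pi)⁻¹ * ‖w y‖ * (‖x - y‖ ^ 2)⁻¹ := hK
        _ ≤ (4 * Real.pi)⁻¹ * 1 * (‖x - y‖ ^ 2)⁻¹ :=
            mul_le_mul_of_nonneg_right (mul_le_mul_of_nonneg_left (hw1 y) (by positivity)) (by positivity)
        _ = (4 * Real.pi)⁻¹ * (nearProfile₂ 1 ‖x - y‖ + 0) := by rw [hprof]; ring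
        _ ≤ M y := by
            simp only [hM]
            exact mul_le_mul_of_nonneg_left (by linarith [hsum0]) (by positivity)
    · -- far: dyadic shells
      push Not at hnear
      have hdy := inv_sq_le_dyadic_sum hnear hdist
      have hind : ∀ k : ℕ, ((4 : ℝ) ^ k)⁻¹ * (if ‖x - y‖ < (2 : ℝ) ^ (k + 1) then (1 : ℝ) else 0) * ‖w y‖ ≤
          ((4 : ℝ) ^ k)⁻¹ * (ball x ((2 : ℝ) ^ (k + 1))).indicator (fun y => ‖V y‖) y := by
        intro k
        rw [mul_assoc]
        refine mul_le_mul_of_nonneg_left ?_ (by positivity)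
        split_ifs with h
        · have hmem : y ∈ ball x ((2 : ℝ) ^ (k + 1)) := by rw [mem_ball, dist_comm, dist_eq_norm]; exact h
          rw [indicator_of_mem hmem, one_mul]
          exact hwV y
        · rw [zero_mul]
          exact Set.indicator_nonneg (fun _ _ => norm_nonneg _) _
      calc ‖biotSavartKernel (x - y) (w y)‖ ≤ (4 * Real.pi)⁻¹ * ‖w y‖ * (‖x - y‖ ^ 2)⁻¹ := hK
        _ = (4 * Real.pi)⁻¹ * ((‖x - y‖ ^ 2)⁻¹ * ‖w y‖) := by ring
        _ ≤ (4 * Real.pi)⁻¹ * ((∑ k ∈ Finset.range (K + 1),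
              ((4 : ℝ) ^ k)⁻¹ * (if ‖x - y‖ < (2 : ℝ) ^ (k + 1) then (1 : ℝ) else 0)) * ‖w y‖) := by
            gcongr
        _ = (4 * Real.pi)⁻¹ * (∑ k ∈ Finset.range (K + 1),
              ((4 : ℝ) ^ k)⁻¹ * (if ‖x - y‖ < (2 : ℝ) ^ (k + 1) then (1 : ℝ) else 0) * ‖w y‖) := by
            rw [Finset.sum_mul]
        _ ≤ (4 * Real.pi)⁻¹ * (∑ k ∈ Finset.range (K + 1),
              ((4 : ℝ) ^ k)⁻¹ * (ball x ((2 : ℝ) ^ (k + 1))).indicator (fun y => ‖V y‖) y) :=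
            mul_le_mul_of_nonneg_left (Finset.sum_le_sum fun k _ => hind k) (by positivity)
        _ ≤ M y := by
            simp only [hM]
            exact mul_le_mul_of_nonneg_left (by linarith [hnear0]) (by positivity)
  -- integrate the majorant
  have hmain : ‖biotSavart w x‖ ≤ ∫ y, M y := by
    unfold biotSavart
    exact norm_integral_le_of_norm_le hMint (Eventually.of_forall hpt)
  refine hmain.trans ?_
  -- compute `∫ M`
  have hnear : ∫ y : EuclideanSpace ℝ (Fin 3), nearProfile₂ 1 ‖x - y‖ = 4 * Real.pi := by
    rw [integral_sub_left_eq_self (fun z : EuclideanSpace ℝ (Fin 3) => nearProfile₂ 1 ‖z‖) volume x,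
      integral_nearProfile₂_norm_eq one_pos, mul_one]
  have hball : ∀ k : ℕ, ∫ y, (ball x ((2 : ℝ) ^ (k + 1))).indicator (fun y => ‖V y‖) y ≤
      ((2 : ℝ) ^ (k + 1)) ^ 2 * (A_E + 4 * Real.pi / 3) / 2 := by
    intro k
    rw [integral_indicator measurableSet_ball]
    exact setIntegral_norm_le_of_ballEnergy hV (by positivity) (hE _ (by positivity))
  have hsum : ∫ y, ∑ k ∈ Finset.range (K + 1),
      ((4 : ℝ) ^ k)⁻¹ * (ball x ((2 : ℝ) ^ (k + 1))).indicator (fun y => ‖V y‖) y ≤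
      ∑ k ∈ Finset.range (K + 1), (2 * (A_E + 4 * Real.pi / 3)) := by
    rw [integral_finsetSum _ fun k _ => (hballint k).const_mul _]
    refine Finset.sum_le_sum fun k _ => ?_
    rw [integral_const_mul]
    calc ((4 : ℝ) ^ k)⁻¹ * ∫ y, (ball x ((2 : ℝ) ^ (k + 1))).indicator (fun y => ‖V y‖) y
        ≤ ((4 : ℝ) ^ k)⁻¹ * (((2 : ℝ) ^ (k + 1)) ^ 2 * (A_E + 4 * Real.pi / 3) / 2) :=
          mul_le_mul_of_nonneg_left (hball k) (by positivity)
      _ = 2 * (A_E + 4 * Real.pi / 3) := by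
          have h4 : ((2 : ℝ) ^ (k + 1)) ^ 2 = 4 * (4 : ℝ) ^ k := by
            have e4 : (4 : ℝ) ^ k = (2 ^ k) ^ 2 := by rw [← pow_mul, mul_comm, pow_mul]; norm_num
            rw [e4, pow_succ]
            ring
          rw [h4]
          field_simp
          ring
  have hAE : 0 ≤ A_E + 4 * Real.pi / 3 := by
    have h := hE 1 one_pos
    have h0 : 0 ≤ ∫ y in ball x 1, ‖V y‖ ^ 2 := integral_nonneg fun y => sq_nonneg _
    have : 0 ≤ A_E := by linarith
    positivity
  calc ∫ y, M y = (4 * Real.pi)⁻¹ * ((∫ y : EuclideanSpace ℝ (Fin 3), nearProfile₂ 1 ‖x - y‖) +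
        ∫ y, ∑ k ∈ Finset.range (K + 1),
          ((4 : ℝ) ^ k)⁻¹ * (ball x ((2 : ℝ) ^ (k + 1))).indicator (fun y => ‖V y‖) y) := by
        rw [hM, integral_const_mul, integral_add hnearint hsumint]
    _ ≤ (4 * Real.pi)⁻¹ * (4 * Real.pi + ∑ k ∈ Finset.range (K + 1), (2 * (A_E + 4 * Real.pi / 3))) := by
        rw [hnear]
        gcongr
    _ = 1 + (K + 1) * (A_E + 4 * Real.pi / 3) / (2 * Real.pi) := by
        rw [Finset.sum_const, Finset.card_range, nsmul_eq_mul]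
        push_cast
        field_simp
        ring

end Summit.NavierStokesRegularity.NavierStokesRegularity.Theorems.NearExtremalTransiencePerFlow.TwoThirds

end
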